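import Summits.HubbardSuperconductivity.HubbardSuperconductivity.Theorems.BcsKacWindowInfraredCompletionBlochReduction

/-!
# Crux `InfraredCompletion` (stmt-HubbardSuperconductivity-1321, route BcsKacWindow), line `birth`:
# spin × Bloch reduction — the quantified corollaries for the two stubs and for the crux

Companion of `BcsKacWindowInfraredCompletionBlochReduction.lean` (the pointwise transfer lemmas
`softWindowFloorAt_of_spinBloch`, `sqrtShapeAt_of_spinBloch`, `orderFloorAt_of_spinBloch`). Here
they are threaded through the quantifier prefix of skeleton v5 of line `birth`:

* `stub_softWindowFloor_of_spinBloch` — stub A (`stub_softWindowFloor`) follows from its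
  restriction to ground states that are joint eigenvectors of all translations and of `spinSq`;
* `stub_sqrtGoldstoneShape_of_spinBloch` — the same for stub B3 (`stub_sqrtGoldstoneShape`);
* `infraredCompletion_of_spinBloch` — the same for the crux ITSELF (body verbatim, conclusion
  restricted to symmetric ground states in the hypothesis): whoever proves the window ⇒ bulk
  transfer for Bloch ground states of definite total spin has proved it for every ground state.

So on this line the every-ground-state clause of the crux ("can fail at level crossings", the
crux's `why it might fail`) is NOT an additional burden: degenerate sector ground multiplets are
handled by symmetry bookkeeping alone. No definitions, no named facts, `sorry`-free.
Sources: H. Tasaki, *Physics and Mathematics of Quantum Many-Body Systems* (2020), §2.1, §4.1;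
E. H. Lieb, PRL **62** (1989) 1201. Lead c15, 2026-08-17. [folklore]
-/

noncomputable section

-- the mandated namespace `Summit.<Summit>.<Problem>.Theorems…` repeats `HubbardSuperconductivity`
-- (single-problem summit, D-0017), which the `dupNamespace` linter flags on every declaration
set_option linter.dupNamespace false

namespace Summit.HubbardSuperconductivity.HubbardSuperconductivity.Theorems.InfraredCompletion

open Literature.MathematicalPhysics.QuantumLattice Literature.Probability.LatticeModels
open scoped Matrix

/-- **Stub A from its spin-Bloch restriction** (registered sub-goal
`stub_softWindowFloor_of_spinBloch`): if the soft-window floor of `stub_softWindowFloor` holds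
for every normalised sector ground state that is an eigenvector of every translation
`fockTranslate v` and of `spinSq`, it holds for every normalised sector ground state (same
constants; `softWindowFloorAt_of_spinBloch` at each datum). Tasaki (2020) §2.1, §4.1. [folklore] -/
theorem stub_softWindowFloor_of_spinBloch :
    (∀ (a b κ₁ κ₂ c₀ s₀ : ℝ) (Δ : ℝ → ℝ), 0 < a → a < b → b < 1 / 2 → 0 < κ₁ → κ₁ ≤ κ₂ → 0 < c₀ →
      0 < s₀ → (∀ U : ℝ, 0 < U → Real.exp (-(κ₂ / U ^ 2)) ≤ Δ U ∧ Δ U ≤ Real.exp (-(κ₁ / U ^ 2))) →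
      (∀ s : ℝ, s₀ ≤ s → ∃ U₁ : ℝ, 0 < U₁ ∧ ∀ δ ∈ Set.Icc a b, ∀ U ∈ Set.Ioo (0:ℝ) U₁,
        ∀ (L : ℕ) [NeZero L], Even L → s₀ ≤ Δ U * L → Δ U * L ≤ s →
          ∀ ψ : Fock (Orb (FermionTorus 2 L)), star ψ ⬝ᵥ ψ = 1 →
            IsGroundStateInSector (hubbardTorus 2 L 1 U) (2 * ⌊(1 - δ) * (L : ℝ) ^ 2 / 2⌋₊) 0 ψ →
              c₀ * Δ U ^ 2 ≤ (expect ((pairField dWaveFormFactor L)ᴴ * pairField dWaveFormFactor L)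
                ψ).re / (L : ℝ) ^ 4) →
      ∃ cA sA : ℝ, 0 < cA ∧ ∀ t : ℝ, sA ≤ t → ∃ UA : ℝ, 0 < UA ∧
        ∀ δ ∈ Set.Icc a b, ∀ U ∈ Set.Ioo (0:ℝ) UA, ∀ (L : ℕ) [NeZero L], Even L → t ≤ Δ U * L →
          ∀ ψ : Fock (Orb (FermionTorus 2 L)), star ψ ⬝ᵥ ψ = 1 →
            IsGroundStateInSector (hubbardTorus 2 L 1 U) (2 * ⌊(1 - δ) * (L : ℝ) ^ 2 / 2⌋₊) 0 ψ →
            (∀ v : TorusSite 2 L, ∃ c : ℂ, (fockTranslate v).val *ᵥ ψ = c • ψ) →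
            (∃ s : ℂ, (spinSq : Matrix (Finset (Orb (FermionTorus 2 L)))
              (Finset (Orb (FermionTorus 2 L))) ℂ) *ᵥ ψ = s • ψ) →
              cA * Δ U ^ 2 * (L : ℝ) ^ 2 ≤
                ∑ m ∈ Finset.univ.filter
                    (fun m : Fin 2 → ZMod L => momentumNormSq L m ≤ (Δ U / t) ^ 2),
                  pairStructureFactor dWaveFormFactor L ψ m) →
    ∀ (a b κ₁ κ₂ c₀ s₀ : ℝ) (Δ : ℝ → ℝ), 0 < a → a < b → b < 1 / 2 → 0 < κ₁ → κ₁ ≤ κ₂ → 0 < c₀ →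
      0 < s₀ → (∀ U : ℝ, 0 < U → Real.exp (-(κ₂ / U ^ 2)) ≤ Δ U ∧ Δ U ≤ Real.exp (-(κ₁ / U ^ 2))) →
      (∀ s : ℝ, s₀ ≤ s → ∃ U₁ : ℝ, 0 < U₁ ∧ ∀ δ ∈ Set.Icc a b, ∀ U ∈ Set.Ioo (0:ℝ) U₁,
        ∀ (L : ℕ) [NeZero L], Even L → s₀ ≤ Δ U * L → Δ U * L ≤ s →
          ∀ ψ : Fock (Orb (FermionTorus 2 L)), star ψ ⬝ᵥ ψ = 1 →
            IsGroundStateInSector (hubbardTorus 2 L 1 U) (2 * ⌊(1 - δ) * (L : ℝ) ^ 2 / 2⌋₊) 0 ψ →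
              c₀ * Δ U ^ 2 ≤ (expect ((pairField dWaveFormFactor L)ᴴ * pairField dWaveFormFactor L)
                ψ).re / (L : ℝ) ^ 4) →
      ∃ cA sA : ℝ, 0 < cA ∧ ∀ t : ℝ, sA ≤ t → ∃ UA : ℝ, 0 < UA ∧
        ∀ δ ∈ Set.Icc a b, ∀ U ∈ Set.Ioo (0:ℝ) UA, ∀ (L : ℕ) [NeZero L], Even L → t ≤ Δ U * L →
          ∀ ψ : Fock (Orb (FermionTorus 2 L)), star ψ ⬝ᵥ ψ = 1 →
            IsGroundStateInSector (hubbardTorus 2 L 1 U) (2 * ⌊(1 - δ) * (L : ℝ) ^ 2 / 2⌋₊) 0 ψ →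
              cA * Δ U ^ 2 * (L : ℝ) ^ 2 ≤
                ∑ m ∈ Finset.univ.filter
                    (fun m : Fin 2 → ZMod L => momentumNormSq L m ≤ (Δ U / t) ^ 2),
                  pairStructureFactor dWaveFormFactor L ψ m := by
  intro hres a b κ₁ κ₂ c₀ s₀ Δ ha hab hb hκ₁ hκ₁₂ hc₀ hs₀ hpin hW
  obtain ⟨cA, sA, hcA, hfl⟩ := hres a b κ₁ κ₂ c₀ s₀ Δ ha hab hb hκ₁ hκ₁₂ hc₀ hs₀ hpin hW
  refine ⟨cA, sA, hcA, fun t ht => ?_⟩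
  obtain ⟨UA, hUA, h⟩ := hfl t ht
  refine ⟨UA, hUA, fun δ hδ U hU L _ hL htL ψ hψ hgs => ?_⟩
  exact softWindowFloorAt_of_spinBloch L U _ (Δ U / t) _
    (fun φ hφ hφgs hbl hsp => h δ hδ U hU L hL htL φ hφ hφgs hbl hsp) ψ hψ hgs

/-- **Stub B3 from its spin-Bloch restriction** (registered sub-goal
`stub_sqrtGoldstoneShape_of_spinBloch`): if the sqrt-shape of `stub_sqrtGoldstoneShape` holds for
every normalised sector ground state that is an eigenvector of every translation and of `spinSq`,
it holds for every normalised sector ground state (same constants; `sqrtShapeAt_of_spinBloch` at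
each datum and label, with `K = D Δ(U) L² + B |q_m| L²`). Tasaki (2020) §2.1, §4.1. [folklore] -/
theorem stub_sqrtGoldstoneShape_of_spinBloch :
    (∀ (a b κ₁ κ₂ c₀ s₀ : ℝ) (Δ : ℝ → ℝ), 0 < a → a < b → b < 1 / 2 → 0 < κ₁ → κ₁ ≤ κ₂ → 0 < c₀ →
      0 < s₀ → (∀ U : ℝ, 0 < U → Real.exp (-(κ₂ / U ^ 2)) ≤ Δ U ∧ Δ U ≤ Real.exp (-(κ₁ / U ^ 2))) →
      (∀ s : ℝ, s₀ ≤ s → ∃ U₁ : ℝ, 0 < U₁ ∧ ∀ δ ∈ Set.Icc a b, ∀ U ∈ Set.Ioo (0:ℝ) U₁,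
        ∀ (L : ℕ) [NeZero L], Even L → s₀ ≤ Δ U * L → Δ U * L ≤ s →
          ∀ ψ : Fock (Orb (FermionTorus 2 L)), star ψ ⬝ᵥ ψ = 1 →
            IsGroundStateInSector (hubbardTorus 2 L 1 U) (2 * ⌊(1 - δ) * (L : ℝ) ^ 2 / 2⌋₊) 0 ψ →
              c₀ * Δ U ^ 2 ≤ (expect ((pairField dWaveFormFactor L)ᴴ * pairField dWaveFormFactor L)
                ψ).re / (L : ℝ) ^ 4) →
      ∃ A D B t₀ UR : ℝ, 0 ≤ A ∧ 0 ≤ D ∧ 0 ≤ B ∧ 0 < t₀ ∧ 0 < UR ∧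
        ∀ δ ∈ Set.Icc a b, ∀ U ∈ Set.Ioo (0:ℝ) UR, ∀ (L : ℕ) [NeZero L], Even L → t₀ ≤ Δ U * L →
          ∀ ψ : Fock (Orb (FermionTorus 2 L)), star ψ ⬝ᵥ ψ = 1 →
            IsGroundStateInSector (hubbardTorus 2 L 1 U) (2 * ⌊(1 - δ) * (L : ℝ) ^ 2 / 2⌋₊) 0 ψ →
            (∀ v : TorusSite 2 L, ∃ c : ℂ, (fockTranslate v).val *ᵥ ψ = c • ψ) →
            (∃ s : ℂ, (spinSq : Matrix (Finset (Orb (FermionTorus 2 L)))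
              (Finset (Orb (FermionTorus 2 L))) ℂ) *ᵥ ψ = s • ψ) →
              ∀ m : Fin 2 → ZMod L, m ≠ 0 → momentumNormSq L m ≤ (Δ U / t₀) ^ 2 →
                pairStructureFactor dWaveFormFactor L ψ m * Real.sqrt (momentumNormSq L m) *
                    (L : ℝ) ^ 2 ≤
                  A * (L : ℝ) * Real.sqrt (pairStructureFactor dWaveFormFactor L ψ 0) +
                    D * Δ U * (L : ℝ) ^ 2 +
                      B * Real.sqrt (momentumNormSq L m) * (L : ℝ) ^ 2) →
    ∀ (a b κ₁ κ₂ c₀ s₀ : ℝ) (Δ : ℝ → ℝ), 0 < a → a < b → b < 1 / 2 → 0 < κ₁ → κ₁ ≤ κ₂ → 0 < c₀ →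
      0 < s₀ → (∀ U : ℝ, 0 < U → Real.exp (-(κ₂ / U ^ 2)) ≤ Δ U ∧ Δ U ≤ Real.exp (-(κ₁ / U ^ 2))) →
      (∀ s : ℝ, s₀ ≤ s → ∃ U₁ : ℝ, 0 < U₁ ∧ ∀ δ ∈ Set.Icc a b, ∀ U ∈ Set.Ioo (0:ℝ) U₁,
        ∀ (L : ℕ) [NeZero L], Even L → s₀ ≤ Δ U * L → Δ U * L ≤ s →
          ∀ ψ : Fock (Orb (FermionTorus 2 L)), star ψ ⬝ᵥ ψ = 1 →
            IsGroundStateInSector (hubbardTorus 2 L 1 U) (2 * ⌊(1 - δ) * (L : ℝ) ^ 2 / 2⌋₊) 0 ψ →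
              c₀ * Δ U ^ 2 ≤ (expect ((pairField dWaveFormFactor L)ᴴ * pairField dWaveFormFactor L)
                ψ).re / (L : ℝ) ^ 4) →
      ∃ A D B t₀ UR : ℝ, 0 ≤ A ∧ 0 ≤ D ∧ 0 ≤ B ∧ 0 < t₀ ∧ 0 < UR ∧
        ∀ δ ∈ Set.Icc a b, ∀ U ∈ Set.Ioo (0:ℝ) UR, ∀ (L : ℕ) [NeZero L], Even L → t₀ ≤ Δ U * L →
          ∀ ψ : Fock (Orb (FermionTorus 2 L)), star ψ ⬝ᵥ ψ = 1 →
            IsGroundStateInSector (hubbardTorus 2 L 1 U) (2 * ⌊(1 - δ) * (L : ℝ) ^ 2 / 2⌋₊) 0 ψ →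
              ∀ m : Fin 2 → ZMod L, m ≠ 0 → momentumNormSq L m ≤ (Δ U / t₀) ^ 2 →
                pairStructureFactor dWaveFormFactor L ψ m * Real.sqrt (momentumNormSq L m) *
                    (L : ℝ) ^ 2 ≤
                  A * (L : ℝ) * Real.sqrt (pairStructureFactor dWaveFormFactor L ψ 0) +
                    D * Δ U * (L : ℝ) ^ 2 +
                      B * Real.sqrt (momentumNormSq L m) * (L : ℝ) ^ 2 := by
  intro hres a b κ₁ κ₂ c₀ s₀ Δ ha hab hb hκ₁ hκ₁₂ hc₀ hs₀ hpin hW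
  obtain ⟨A, D, B, t₀, UR, hA, hD, hB, ht₀, hUR, h⟩ := hres a b κ₁ κ₂ c₀ s₀ Δ ha hab hb hκ₁ hκ₁₂ hc₀ hs₀ hpin hW
  refine ⟨A, D, B, t₀, UR, hA, hD, hB, ht₀, hUR, fun δ hδ U hU L _ hL htL ψ hψ hgs m hm0 hm => ?_⟩
  have key := sqrtShapeAt_of_spinBloch L U _ m A
    (D * Δ U * (L : ℝ) ^ 2 + B * Real.sqrt (momentumNormSq L m) * (L : ℝ) ^ 2) hA
    (fun φ hφ hφgs hbl hsp => by
      have h1 := h δ hδ U hU L hL htL φ hφ hφgs hbl hsp m hm0 hm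
      rw [← add_assoc]
      exact h1) ψ hψ hgs
  rw [← add_assoc] at key
  exact key

/-- **The crux from its spin-Bloch restriction** (`infraredCompletion_of_spinBloch`): the body of
`Summit.HubbardSuperconductivity.HubbardSuperconductivity.Theses.BcsKacWindow.InfraredCompletion`
(verbatim, inlined) follows from the same statement with the bulk-order CONCLUSION asserted only
for normalised sector ground states that are eigenvectors of every translation and of `spinSq`
(same `c₁, s₁, U₁`; `orderFloorAt_of_spinBloch` at each datum). So the window ⇒ bulk transfer
need only be proved for symmetric ground states. Tasaki (2020) §2.1, §4.1. [folklore] -/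
theorem infraredCompletion_of_spinBloch :
    (∀ (a b κ₁ κ₂ c₀ s₀ : ℝ) (Δ : ℝ → ℝ), 0 < a → a < b → b < 1 / 2 → 0 < κ₁ → κ₁ ≤ κ₂ → 0 < c₀ →
      0 < s₀ → (∀ U : ℝ, 0 < U → Real.exp (-(κ₂ / U ^ 2)) ≤ Δ U ∧ Δ U ≤ Real.exp (-(κ₁ / U ^ 2))) →
      (∀ s : ℝ, s₀ ≤ s → ∃ U₁ : ℝ, 0 < U₁ ∧ ∀ δ ∈ Set.Icc a b, ∀ U ∈ Set.Ioo (0:ℝ) U₁,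
        ∀ (L : ℕ) [NeZero L], Even L → s₀ ≤ Δ U * L → Δ U * L ≤ s →
          ∀ ψ : Fock (Orb (FermionTorus 2 L)), star ψ ⬝ᵥ ψ = 1 →
            IsGroundStateInSector (hubbardTorus 2 L 1 U) (2 * ⌊(1 - δ) * (L : ℝ) ^ 2 / 2⌋₊) 0 ψ →
              c₀ * Δ U ^ 2 ≤ (expect ((pairField dWaveFormFactor L)ᴴ * pairField dWaveFormFactor L)
                ψ).re / (L : ℝ) ^ 4) →
      ∃ c₁ s₁ U₁ : ℝ, 0 < c₁ ∧ 0 < U₁ ∧ ∀ δ ∈ Set.Icc a b, ∀ U ∈ Set.Ioo (0:ℝ) U₁,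
        ∀ (L : ℕ) [NeZero L], Even L → s₁ ≤ Δ U * L →
          ∀ ψ : Fock (Orb (FermionTorus 2 L)), star ψ ⬝ᵥ ψ = 1 →
            IsGroundStateInSector (hubbardTorus 2 L 1 U) (2 * ⌊(1 - δ) * (L : ℝ) ^ 2 / 2⌋₊) 0 ψ →
            (∀ v : TorusSite 2 L, ∃ c : ℂ, (fockTranslate v).val *ᵥ ψ = c • ψ) →
            (∃ s : ℂ, (spinSq : Matrix (Finset (Orb (FermionTorus 2 L)))
              (Finset (Orb (FermionTorus 2 L))) ℂ) *ᵥ ψ = s • ψ) →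
              c₁ * Δ U ^ 2 ≤ (expect ((pairField dWaveFormFactor L)ᴴ * pairField dWaveFormFactor L)
                ψ).re / (L : ℝ) ^ 4) →
    ∀ (a b κ₁ κ₂ c₀ s₀ : ℝ) (Δ : ℝ → ℝ), 0 < a → a < b → b < 1 / 2 → 0 < κ₁ → κ₁ ≤ κ₂ → 0 < c₀ →
      0 < s₀ → (∀ U : ℝ, 0 < U → Real.exp (-(κ₂ / U ^ 2)) ≤ Δ U ∧ Δ U ≤ Real.exp (-(κ₁ / U ^ 2))) →
      (∀ s : ℝ, s₀ ≤ s → ∃ U₁ : ℝ, 0 < U₁ ∧ ∀ δ ∈ Set.Icc a b, ∀ U ∈ Set.Ioo (0:ℝ) U₁,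
        ∀ (L : ℕ) [NeZero L], Even L → s₀ ≤ Δ U * L → Δ U * L ≤ s →
          ∀ ψ : Fock (Orb (FermionTorus 2 L)), star ψ ⬝ᵥ ψ = 1 →
            IsGroundStateInSector (hubbardTorus 2 L 1 U) (2 * ⌊(1 - δ) * (L : ℝ) ^ 2 / 2⌋₊) 0 ψ →
              c₀ * Δ U ^ 2 ≤ (expect ((pairField dWaveFormFactor L)ᴴ * pairField dWaveFormFactor L)
                ψ).re / (L : ℝ) ^ 4) →
      ∃ c₁ s₁ U₁ : ℝ, 0 < c₁ ∧ 0 < U₁ ∧ ∀ δ ∈ Set.Icc a b, ∀ U ∈ Set.Ioo (0:ℝ) U₁,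
        ∀ (L : ℕ) [NeZero L], Even L → s₁ ≤ Δ U * L →
          ∀ ψ : Fock (Orb (FermionTorus 2 L)), star ψ ⬝ᵥ ψ = 1 →
            IsGroundStateInSector (hubbardTorus 2 L 1 U) (2 * ⌊(1 - δ) * (L : ℝ) ^ 2 / 2⌋₊) 0 ψ →
              c₁ * Δ U ^ 2 ≤ (expect ((pairField dWaveFormFactor L)ᴴ * pairField dWaveFormFactor L)
                ψ).re / (L : ℝ) ^ 4 := by
  intro hres a b κ₁ κ₂ c₀ s₀ Δ ha hab hb hκ₁ hκ₁₂ hc₀ hs₀ hpin hW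
  obtain ⟨c₁, s₁, U₁, hc₁, hU₁, h⟩ := hres a b κ₁ κ₂ c₀ s₀ Δ ha hab hb hκ₁ hκ₁₂ hc₀ hs₀ hpin hW
  refine ⟨c₁, s₁, U₁, hc₁, hU₁, fun δ hδ U hU L _ hL hsL ψ hψ hgs => ?_⟩
  exact orderFloorAt_of_spinBloch L U _ (c₁ * Δ U ^ 2)
    (fun φ hφ hφgs hbl hsp => h δ hδ U hU L hL hsL φ hφ hφgs hbl hsp) ψ hψ hgs

end Summit.HubbardSuperconductivity.HubbardSuperconductivity.Theorems.InfraredCompletion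

end
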